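import Literature.NumberTheory.Automorphic.ExteriorSquareNoHeckeEigenvalueGL4
import HarnessLib

/-!
# No pair-product Hecke character for a cuspidal, not essentially self-dual `π` on `GL₄` with
# cuspidal exterior square (the `(2,2)` case of a reducible compatible system is empty) — proofs only

Topic `NumberTheory/Automorphic`; namespace `Literature.NumberTheory.Automorphic`.  PROOFS file (theorems
only: no definition, no named fact, no `sorry`), companion of `ExteriorSquareNoHeckeEigenvalueGL4` (the
`(3,1)` case).  Let `π` be a cuspidal Borel–Jacquet datum on `GL₄(𝔸_F)`, NOT essentially self-dual at Satake
level, whose exterior-square Satake data are those of a CUSPIDAL datum `Π` on `GL₆(𝔸_F)` a.e.; then NO Hecke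
character `χ` splits the Satake multisets as `t_{π,v} = β_v ⊔ γ_v`, `|β_v| = 2`, `∏ β_v = χ(ϖ_v)` a.e. —
granting Jacquet–Shalika (2.2) and (2.3) for Borel–Jacquet data.  This is the analytic half of the `(2,2)`
case of A. Shavali, arXiv:2603.19768 (2026), Prop. 4.2, for any number field and WITHOUT weight hypotheses,
by the dual-pair Rankin–Selberg syzygy (46-term identity `λ·V = λ·W`) instead of the exterior cube.

This file contains the ABSTRACT parts: the pole bookkeeping for an identity of six against six functions
(`false_of_limits_six_six`) and the passage from an identity of Euler factors to an identity of six-fold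
products of partial `L`-functions (`partialPairL_prod_six_eq_of_satakePairPolynomial_eq`).

## References

* A. Shavali, arXiv:2603.19768 (2026), Prop. 4.2 (the `(2,2)` case). [Shavali2026GL4]
* J. Arthur, L. Clozel, Ann. of Math. Stud. 120 (1989), Ch. 3 §2, (2.1)–(2.3). [ArthurClozelAMS120]
* H. Jacquet, J. A. Shalika, Amer. J. Math. 103 (1981), II Prop. 3.6, Thm. 4.4. [JacquetShalikaAJM1981II]
-/

noncomputable section

open scoped Topology Classical NumberField
open NumberField IsDedekindDomain Filter Polynomial

namespace Literature.NumberTheory.Automorphic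

/-! ### Pole bookkeeping: six factors against six -/

section Bookkeeping

variable {F : Type} [Field F] [NumberField F]

/-- **Pole bookkeeping, six factors against six.**  Along a non-trivial filter `l` with `s - 1 → 0`:
suppose `A₁ A₂ A₃ A₄ A₅ Z = B₁ B₂ B₃ B₄ B₅ B₆` eventually, `(s - 1)^{eᵢ} Aᵢ → aᵢ ≠ 0`, `(s - 1) Z → z ≠ 0`
and `(s - 1)^{fⱼ} Bⱼ → bⱼ` (finite), with `e₁ + ⋯ + e₅ = d + f₁ + ⋯ + f₆` for some `d : ℕ` (the left side
has strictly more poles, counted with `Z`).  Multiplying by `(s - 1)^{e₁ + ⋯ + e₅ + 1}`, the left side tends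
to `a₁ ⋯ a₅ z ≠ 0` and the right side to `0^{d+1} b₁ ⋯ b₆ = 0` — a contradiction. [folklore] -/
theorem false_of_limits_six_six {l : Filter ℂ} [l.NeBot]
    {A₁ A₂ A₃ A₄ A₅ Z B₁ B₂ B₃ B₄ B₅ B₆ : ℂ → ℂ}
    {a₁ a₂ a₃ a₄ a₅ z b₁ b₂ b₃ b₄ b₅ b₆ : ℂ}
    {e₁ e₂ e₃ e₄ e₅ f₁ f₂ f₃ f₄ f₅ f₆ d : ℕ}
    (he : e₁ + e₂ + e₃ + e₄ + e₅ = d + f₁ + f₂ + f₃ + f₄ + f₅ + f₆)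
    (hsub : Tendsto (fun s => s - 1) l (𝓝 0))
    (hEq : ∀ᶠ s in l, A₁ s * A₂ s * A₃ s * A₄ s * A₅ s * Z s = B₁ s * B₂ s * B₃ s * B₄ s * B₅ s * B₆ s)
    (hA₁ : Tendsto (fun s => (s - 1) ^ e₁ * A₁ s) l (𝓝 a₁)) (ha₁ : a₁ ≠ 0)
    (hA₂ : Tendsto (fun s => (s - 1) ^ e₂ * A₂ s) l (𝓝 a₂)) (ha₂ : a₂ ≠ 0)
    (hA₃ : Tendsto (fun s => (s - 1) ^ e₃ * A₃ s) l (𝓝 a₃)) (ha₃ : a₃ ≠ 0)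
    (hA₄ : Tendsto (fun s => (s - 1) ^ e₄ * A₄ s) l (𝓝 a₄)) (ha₄ : a₄ ≠ 0)
    (hA₅ : Tendsto (fun s => (s - 1) ^ e₅ * A₅ s) l (𝓝 a₅)) (ha₅ : a₅ ≠ 0)
    (hZ : Tendsto (fun s => (s - 1) * Z s) l (𝓝 z)) (hz : z ≠ 0)
    (hB₁ : Tendsto (fun s => (s - 1) ^ f₁ * B₁ s) l (𝓝 b₁))
    (hB₂ : Tendsto (fun s => (s - 1) ^ f₂ * B₂ s) l (𝓝 b₂))
    (hB₃ : Tendsto (fun s => (s - 1) ^ f₃ * B₃ s) l (𝓝 b₃))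
    (hB₄ : Tendsto (fun s => (s - 1) ^ f₄ * B₄ s) l (𝓝 b₄))
    (hB₅ : Tendsto (fun s => (s - 1) ^ f₅ * B₅ s) l (𝓝 b₅))
    (hB₆ : Tendsto (fun s => (s - 1) ^ f₆ * B₆ s) l (𝓝 b₆)) : False := by
  have h1 : Tendsto (fun s => ((s - 1) ^ e₁ * A₁ s) * ((s - 1) ^ e₂ * A₂ s) * ((s - 1) ^ e₃ * A₃ s) *
      ((s - 1) ^ e₄ * A₄ s) * ((s - 1) ^ e₅ * A₅ s) * ((s - 1) * Z s)) l
      (𝓝 (a₁ * a₂ * a₃ * a₄ * a₅ * z)) :=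
    ((((hA₁.mul hA₂).mul hA₃).mul hA₄).mul hA₅).mul hZ
  have h2 : Tendsto (fun s => (s - 1) ^ (d + 1) * (((s - 1) ^ f₁ * B₁ s) * ((s - 1) ^ f₂ * B₂ s) *
      ((s - 1) ^ f₃ * B₃ s) * ((s - 1) ^ f₄ * B₄ s) * ((s - 1) ^ f₅ * B₅ s) * ((s - 1) ^ f₆ * B₆ s))) l
      (𝓝 ((0 : ℂ) ^ (d + 1) * (b₁ * b₂ * b₃ * b₄ * b₅ * b₆))) :=
    (hsub.pow (d + 1)).mul (((((hB₁.mul hB₂).mul hB₃).mul hB₄).mul hB₅).mul hB₆)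
  rw [zero_pow (Nat.succ_ne_zero d), zero_mul] at h2
  have heq : (fun s => (s - 1) ^ (d + 1) * (((s - 1) ^ f₁ * B₁ s) * ((s - 1) ^ f₂ * B₂ s) *
      ((s - 1) ^ f₃ * B₃ s) * ((s - 1) ^ f₄ * B₄ s) * ((s - 1) ^ f₅ * B₅ s) * ((s - 1) ^ f₆ * B₆ s))) =ᶠ[l]
      fun s => ((s - 1) ^ e₁ * A₁ s) * ((s - 1) ^ e₂ * A₂ s) * ((s - 1) ^ e₃ * A₃ s) *
        ((s - 1) ^ e₄ * A₄ s) * ((s - 1) ^ e₅ * A₅ s) * ((s - 1) * Z s) :=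
    hEq.mono fun s hs => by
      calc (s - 1) ^ (d + 1) * (((s - 1) ^ f₁ * B₁ s) * ((s - 1) ^ f₂ * B₂ s) *
            ((s - 1) ^ f₃ * B₃ s) * ((s - 1) ^ f₄ * B₄ s) * ((s - 1) ^ f₅ * B₅ s) * ((s - 1) ^ f₆ * B₆ s))
          = (s - 1) ^ (d + f₁ + f₂ + f₃ + f₄ + f₅ + f₆ + 1) *
              (B₁ s * B₂ s * B₃ s * B₄ s * B₅ s * B₆ s) := by ring
        _ = (s - 1) ^ (e₁ + e₂ + e₃ + e₄ + e₅ + 1) * (A₁ s * A₂ s * A₃ s * A₄ s * A₅ s * Z s) := by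
              rw [← he, hs]
        _ = ((s - 1) ^ e₁ * A₁ s) * ((s - 1) ^ e₂ * A₂ s) * ((s - 1) ^ e₃ * A₃ s) *
              ((s - 1) ^ e₄ * A₄ s) * ((s - 1) ^ e₅ * A₅ s) * ((s - 1) * Z s) := by ring
  exact mul_ne_zero (mul_ne_zero (mul_ne_zero (mul_ne_zero (mul_ne_zero ha₁ ha₂) ha₃) ha₄) ha₅) hz
    (tendsto_nhds_unique h1 (h2.congr' heq))

/-- **An identity of six-fold products of partial `L`-functions from an identity of Euler factors**: if
off `S` the products of the six Rankin–Selberg polynomials on each side agree and the twelve Euler products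
are multipliable at `s`, then the six-fold products of partial `L`-functions agree at `s`. [folklore] -/
theorem partialPairL_prod_six_eq_of_satakePairPolynomial_eq {S : Set (HeightOneSpectrum (𝓞 F))}
    {p₁ q₁ p₂ q₂ p₃ q₃ p₄ q₄ p₅ q₅ p₆ q₆ a₁ b₁ a₂ b₂ a₃ b₃ a₄ b₄ a₅ b₅ a₆ b₆ : SatakeFamily F}
    (hId : ∀ v ∉ S,
      satakePairPolynomial (p₁ v) (q₁ v) * satakePairPolynomial (p₂ v) (q₂ v) *
          satakePairPolynomial (p₃ v) (q₃ v) * satakePairPolynomial (p₄ v) (q₄ v) *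
          satakePairPolynomial (p₅ v) (q₅ v) * satakePairPolynomial (p₆ v) (q₆ v) =
        satakePairPolynomial (a₁ v) (b₁ v) * satakePairPolynomial (a₂ v) (b₂ v) *
          satakePairPolynomial (a₃ v) (b₃ v) * satakePairPolynomial (a₄ v) (b₄ v) *
          satakePairPolynomial (a₅ v) (b₅ v) * satakePairPolynomial (a₆ v) (b₆ v))
    {s : ℂ}
    (m₁ : Multipliable fun v : {v : HeightOneSpectrum (𝓞 F) // v ∉ S} =>
      ((satakePairPolynomial (p₁ v.1) (q₁ v.1)).eval ((v.1.residueCard : ℂ) ^ (-s)))⁻¹)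
    (m₂ : Multipliable fun v : {v : HeightOneSpectrum (𝓞 F) // v ∉ S} =>
      ((satakePairPolynomial (p₂ v.1) (q₂ v.1)).eval ((v.1.residueCard : ℂ) ^ (-s)))⁻¹)
    (m₃ : Multipliable fun v : {v : HeightOneSpectrum (𝓞 F) // v ∉ S} =>
      ((satakePairPolynomial (p₃ v.1) (q₃ v.1)).eval ((v.1.residueCard : ℂ) ^ (-s)))⁻¹)
    (m₄ : Multipliable fun v : {v : HeightOneSpectrum (𝓞 F) // v ∉ S} =>
      ((satakePairPolynomial (p₄ v.1) (q₄ v.1)).eval ((v.1.residueCard : ℂ) ^ (-s)))⁻¹)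
    (m₅ : Multipliable fun v : {v : HeightOneSpectrum (𝓞 F) // v ∉ S} =>
      ((satakePairPolynomial (p₅ v.1) (q₅ v.1)).eval ((v.1.residueCard : ℂ) ^ (-s)))⁻¹)
    (m₆ : Multipliable fun v : {v : HeightOneSpectrum (𝓞 F) // v ∉ S} =>
      ((satakePairPolynomial (p₆ v.1) (q₆ v.1)).eval ((v.1.residueCard : ℂ) ^ (-s)))⁻¹)
    (n₁ : Multipliable fun v : {v : HeightOneSpectrum (𝓞 F) // v ∉ S} =>
      ((satakePairPolynomial (a₁ v.1) (b₁ v.1)).eval ((v.1.residueCard : ℂ) ^ (-s)))⁻¹)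
    (n₂ : Multipliable fun v : {v : HeightOneSpectrum (𝓞 F) // v ∉ S} =>
      ((satakePairPolynomial (a₂ v.1) (b₂ v.1)).eval ((v.1.residueCard : ℂ) ^ (-s)))⁻¹)
    (n₃ : Multipliable fun v : {v : HeightOneSpectrum (𝓞 F) // v ∉ S} =>
      ((satakePairPolynomial (a₃ v.1) (b₃ v.1)).eval ((v.1.residueCard : ℂ) ^ (-s)))⁻¹)
    (n₄ : Multipliable fun v : {v : HeightOneSpectrum (𝓞 F) // v ∉ S} =>
      ((satakePairPolynomial (a₄ v.1) (b₄ v.1)).eval ((v.1.residueCard : ℂ) ^ (-s)))⁻¹)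
    (n₅ : Multipliable fun v : {v : HeightOneSpectrum (𝓞 F) // v ∉ S} =>
      ((satakePairPolynomial (a₅ v.1) (b₅ v.1)).eval ((v.1.residueCard : ℂ) ^ (-s)))⁻¹)
    (n₆ : Multipliable fun v : {v : HeightOneSpectrum (𝓞 F) // v ∉ S} =>
      ((satakePairPolynomial (a₆ v.1) (b₆ v.1)).eval ((v.1.residueCard : ℂ) ^ (-s)))⁻¹) :
    partialPairL S p₁ q₁ s * partialPairL S p₂ q₂ s * partialPairL S p₃ q₃ s *
        partialPairL S p₄ q₄ s * partialPairL S p₅ q₅ s * partialPairL S p₆ q₆ s =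
      partialPairL S a₁ b₁ s * partialPairL S a₂ b₂ s * partialPairL S a₃ b₃ s *
        partialPairL S a₄ b₄ s * partialPairL S a₅ b₅ s * partialPairL S a₆ b₆ s := by
  unfold partialPairL
  rw [← m₁.tprod_mul m₂, ← (m₁.mul m₂).tprod_mul m₃, ← ((m₁.mul m₂).mul m₃).tprod_mul m₄,
    ← (((m₁.mul m₂).mul m₃).mul m₄).tprod_mul m₅, ← ((((m₁.mul m₂).mul m₃).mul m₄).mul m₅).tprod_mul m₆,
    ← n₁.tprod_mul n₂, ← (n₁.mul n₂).tprod_mul n₃, ← ((n₁.mul n₂).mul n₃).tprod_mul n₄,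
    ← (((n₁.mul n₂).mul n₃).mul n₄).tprod_mul n₅, ← ((((n₁.mul n₂).mul n₃).mul n₄).mul n₅).tprod_mul n₆]
  congr 1
  funext v
  rw [← mul_inv, ← mul_inv, ← mul_inv, ← mul_inv, ← mul_inv, ← mul_inv, ← mul_inv, ← mul_inv, ← mul_inv,
    ← mul_inv, ← eval_mul, ← eval_mul, ← eval_mul, ← eval_mul, ← eval_mul, ← eval_mul, ← eval_mul,
    ← eval_mul, ← eval_mul, ← eval_mul, hId v.1 v.2]

end Bookkeeping


/-! ### From Hecke characters to the abstract bookkeeping -/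

section Construction

variable {F : Type} [Field F] [NumberField F]

open Literature.NumberTheory.GaloisRepresentations (HeckeCharacter ideleGroup)

/-- `‖(q_v : ℂ) ^ z‖ = q_v ^ {re z}`. [folklore] -/
private theorem norm_qpow_twoTwo (v : HeightOneSpectrum (𝓞 F)) (z : ℂ) :
    ‖(v.residueCard : ℂ) ^ z‖ = (v.residueCard : ℝ) ^ z.re :=
  Complex.norm_natCast_cpow_of_pos (Nat.zero_lt_of_lt v.one_lt_residueCard) z

/-- `(q_v : ℂ) ^ z ≠ 0`. [folklore] -/
private theorem qpow_ne_zero_twoTwo (v : HeightOneSpectrum (𝓞 F)) (z : ℂ) :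
    (v.residueCard : ℂ) ^ z ≠ 0 := by
  have hq : (v.residueCard : ℂ) ≠ 0 :=
    Nat.cast_ne_zero.2 (ne_of_gt (lt_trans zero_lt_one v.one_lt_residueCard))
  exact fun h => hq ((Complex.cpow_eq_zero_iff _ _).1 h).1

/-- Shifting no family: `γ w = q_w^{0} γ w`. [folklore] -/
private theorem shift_zero_twoTwo {S : Set (HeightOneSpectrum (𝓞 F))} (γ : SatakeFamily F) :
    ∀ w ∉ S, γ w = (γ w).map (((w.residueCard : ℂ) ^ (0 : ℂ)) * ·) := fun w _ => by
  simp only [Complex.cpow_zero, one_mul, Multiset.map_id']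

/-- `(m · u)⁻¹ = u⁻¹ · m⁻¹` entrywise: the inverse of a twisted family is the twist of the inverse family
by the inverse character. [folklore] -/
theorem map_inv_map_const_mul (m : Multiset ℂ) (u : ℂ) :
    (m.map (u * ·)).map (·⁻¹) = (m.map (·⁻¹)).map (u⁻¹ * ·) := by
  rw [Multiset.map_map, Multiset.map_map]
  refine Multiset.map_congr rfl fun x _ => ?_
  simp only [Function.comp_apply, mul_inv]

/-- Composing two twists. [folklore] -/
theorem map_const_mul_map_const_mul (m : Multiset ℂ) (u u' : ℂ) :
    (m.map (u * ·)).map (u' * ·) = m.map ((u' * u) * ·) := by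
  rw [Multiset.map_map]
  refine Multiset.map_congr rfl fun x _ => ?_
  simp only [Function.comp_apply, mul_assoc]

/-- `{a, b} + {c, d} = {a, b, c, d}`. [folklore] -/
theorem pair_add_pair (a b c d : ℂ) :
    ({a, b} : Multiset ℂ) + {c, d} = {a, b, c, d} := by
  simp only [Multiset.insert_eq_cons, Multiset.cons_add, Multiset.singleton_add]

/-- **No pair-product Hecke character for a unitary cuspidal datum on `GL₄`, not essentially self-dual,
with cuspidal exterior square; slope `≥ 0`.**  Let `P` be a cuspidal datum on `GL₄(𝔸_F)` with unitary
Satake family `β` a.e., `Pd` one with the inverse family `β⁻¹` a.e., `Q` a cuspidal datum on `GL₆(𝔸_F)` with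
family `∧² β` a.e., `ω` a Hecke character with `ω(ϖ_w) = det β_w` a.e.; assume NO Hecke character `e` has
`β_w⁻¹ = e(ϖ_w) β_w` a.e. (`P` not essentially self-dual at Satake level), and let `χ` be a Hecke character
splitting `β_w = S_w + T_w`, `|S_w| = 2`, `∏ S_w = χ(ϖ_w)` a.e., with `|χ| = ‖·‖^{-t}`, `t ≥ 0` (so
`|χ(ϖ_w)| = q_w^{t}`).  Granting the `GL_n × GL_n` and `GL₁ × GL₁` analytic packages (hypotheses `hPk`,
`hGl`: Jacquet–Shalika (2.1)–(2.3) for Borel–Jacquet data + Hecke), Jacquet–Shalika (2.2) (`hJ2`, for the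
`GL₆ × GL₁` slots through `analyticPackage_repData`) and the 46-term identity (`hId46`), `False`.  With
`λ = ‖·‖^{-t}`, `u₁ = χ⁻¹ λ⁻¹` (unitary) and the unitary a.e. characters `ω^i u₁^j`, the twelve twisting
characters `ω^i χ^{-j}` of the identity
`L(P×Pd⊗λ) L(P×Pd⊗λ²) L(Q⊗χ⁻¹λ)² ζ L(λ³) = L(P×P⊗χ⁻¹λ) L(Pd×Pd⊗χλ²) L(Q⊗χ⁻¹) L(Q⊗χ⁻¹λ²) L(λ) L(λ²)`
(`λ = ω χ⁻²`; shifts `j t` with `j = 2,4,3,3,0,6 ‖ 3,3,1,5,2,4`) are `q^{-jt} (ω^i u₁^j)(ϖ)`; for `t = 0` the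
left side has a pole of order `≥ 1 + [λ = 1] + [λ² = 1]` (Hecke; (2.3) for `P × Pd` in the `X`-case, (2.2)
non-vanishing elsewhere) and the right side at most `[λ = 1] + [λ² = 1]` (the two `GL₄ × GL₄` pairs are off
`X` by `¬` ess-self-dual); for `t > 0` every shifted factor is evaluated inside `Re s > 1` (continuous, and
non-zero on the left) against the pole of `ζ_F^S` (`false_of_limits_six_six`).
[cite: Shavali2026GL4, Prop. 4.2] [cite: ArthurClozelAMS120, Ch. 3 §2 (2.1)–(2.3)] -/
theorem false_of_pairSplit_satake_gl4
    (hPk :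
      ∀ (F : Type) [Field F] [NumberField F] (n : ℕ) [NeZero n]
      (hF : Literature.NumberTheory.Automorphic.isCompact_glFiniteIntegralLevel n F),
      Literature.NumberTheory.Automorphic.JacquetShalika1981_partialPairL_boundary_repData →
      Literature.NumberTheory.Automorphic.JacquetShalika1981_partialPairL_pole_repData →
      ∀ (P₁ P₂ : Literature.NumberTheory.Automorphic.CuspidalAutomorphicRepData n F hF)
      (β₁ β₂ : Literature.NumberTheory.Automorphic.SatakeFamily F),
      (∀ᶠ w : IsDedekindDomain.HeightOneSpectrum (NumberField.RingOfIntegers F) in Filter.cofinite,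
      P₁.1.HasSatakeParamAt w (β₁ w)) →
      (∀ᶠ w : IsDedekindDomain.HeightOneSpectrum (NumberField.RingOfIntegers F) in Filter.cofinite,
      P₂.1.HasSatakeParamAt w (β₂ w)) →
      (∀ᶠ w : IsDedekindDomain.HeightOneSpectrum (NumberField.RingOfIntegers F) in Filter.cofinite,
      ‖(β₁ w).prod‖ = 1) →
      (∀ᶠ w : IsDedekindDomain.HeightOneSpectrum (NumberField.RingOfIntegers F) in Filter.cofinite,
      ‖(β₂ w).prod‖ = 1) →
      ∃ S₀ : Set (IsDedekindDomain.HeightOneSpectrum (NumberField.RingOfIntegers F)), S₀.Finite ∧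
      ∀ (S : Set (IsDedekindDomain.HeightOneSpectrum (NumberField.RingOfIntegers F))),
      S.Finite → S₀ ⊆ S →
      (∀ s : ℂ, 1 < s.re → Multipliable fun v :
      {v : IsDedekindDomain.HeightOneSpectrum (NumberField.RingOfIntegers F) // v ∉ S} =>
      ((Literature.NumberTheory.Automorphic.satakePairPolynomial (β₁ v.1) (β₂ v.1)).eval
      ((v.1.residueCard : ℂ) ^ (-s)))⁻¹) ∧
      (∀ s : ℂ, 1 < s.re →
      ContinuousAt (Literature.NumberTheory.Automorphic.partialPairL S β₁ β₂) s ∧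
      Literature.NumberTheory.Automorphic.partialPairL S β₁ β₂ s ≠ 0) ∧
      ((∀ᶠ w : IsDedekindDomain.HeightOneSpectrum (NumberField.RingOfIntegers F) in Filter.cofinite,
      β₁ w = (β₂ w).map (·⁻¹)) →
      ∃ c : ℂ, c ≠ 0 ∧ Filter.Tendsto
      (fun s : ℂ => (s - 1) * Literature.NumberTheory.Automorphic.partialPairL S β₁ β₂ s)
      (nhdsWithin 1 {s : ℂ | 1 < s.re}) (nhds c)) ∧
      ((¬ ∀ᶠ w : IsDedekindDomain.HeightOneSpectrum (NumberField.RingOfIntegers F) in Filter.cofinite,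
      β₁ w = (β₂ w).map (·⁻¹)) →
      ∃ c : ℂ, c ≠ 0 ∧ Filter.Tendsto (Literature.NumberTheory.Automorphic.partialPairL S β₁ β₂)
      (nhdsWithin 1 {s : ℂ | 1 < s.re}) (nhds c)))
    (hGl :
      ∀ (F : Type) [Field F] [NumberField F]
      (u : Literature.NumberTheory.GaloisRepresentations.HeckeCharacter F),
      (∀ᶠ w : IsDedekindDomain.HeightOneSpectrum (NumberField.RingOfIntegers F) in Filter.cofinite,
      ‖u.valueAtUniformizer w‖ = 1) →
      ∃ S₀ : Set (IsDedekindDomain.HeightOneSpectrum (NumberField.RingOfIntegers F)), S₀.Finite ∧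
      ∀ (S : Set (IsDedekindDomain.HeightOneSpectrum (NumberField.RingOfIntegers F))),
      S.Finite → S₀ ⊆ S →
      (∀ s : ℂ, 1 < s.re → Multipliable fun v :
      {v : IsDedekindDomain.HeightOneSpectrum (NumberField.RingOfIntegers F) // v ∉ S} =>
      ((Literature.NumberTheory.Automorphic.satakePairPolynomial {u.valueAtUniformizer v.1} {1}).eval
      ((v.1.residueCard : ℂ) ^ (-s)))⁻¹) ∧
      (∀ s : ℂ, 1 < s.re →
      ContinuousAt (Literature.NumberTheory.Automorphic.partialPairL S
      (fun w => {u.valueAtUniformizer w}) (fun _ => {1})) s ∧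
      Literature.NumberTheory.Automorphic.partialPairL S
      (fun w => {u.valueAtUniformizer w}) (fun _ => {1}) s ≠ 0) ∧
      ((∀ᶠ w : IsDedekindDomain.HeightOneSpectrum (NumberField.RingOfIntegers F) in Filter.cofinite,
      u.valueAtUniformizer w = 1) →
      ∃ c : ℂ, c ≠ 0 ∧ Filter.Tendsto
      (fun s : ℂ => (s - 1) * Literature.NumberTheory.Automorphic.partialPairL S
      (fun w => {u.valueAtUniformizer w}) (fun _ => {1}) s)
      (nhdsWithin 1 {s : ℂ | 1 < s.re}) (nhds c)) ∧
      ((¬ ∀ᶠ w : IsDedekindDomain.HeightOneSpectrum (NumberField.RingOfIntegers F) in Filter.cofinite,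
      u.valueAtUniformizer w = 1) →
      ∃ c : ℂ, c ≠ 0 ∧ Filter.Tendsto
      (Literature.NumberTheory.Automorphic.partialPairL S
      (fun w => {u.valueAtUniformizer w}) (fun _ => {1}))
      (nhdsWithin 1 {s : ℂ | 1 < s.re}) (nhds c)))
    (hId46 :
      ∀ (a b c d : ℂ), a ≠ 0 → b ≠ 0 → c ≠ 0 → d ≠ 0 →
      Literature.NumberTheory.Automorphic.satakePairPolynomial {a, b, c, d}
      ((({a, b, c, d} : Multiset ℂ).map (·⁻¹)).map (c * d * (a * b)⁻¹ * ·)) *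
      Literature.NumberTheory.Automorphic.satakePairPolynomial {a, b, c, d}
      ((({a, b, c, d} : Multiset ℂ).map (·⁻¹)).map ((c * d * (a * b)⁻¹) ^ 2 * ·)) *
      Literature.NumberTheory.Automorphic.satakePairPolynomial
      (Literature.NumberTheory.Automorphic.wedgeTwoParams {a, b, c, d})
      {(a * b)⁻¹ * (c * d * (a * b)⁻¹)} *
      Literature.NumberTheory.Automorphic.satakePairPolynomial
      (Literature.NumberTheory.Automorphic.wedgeTwoParams {a, b, c, d})
      {(a * b)⁻¹ * (c * d * (a * b)⁻¹)} *
      Literature.NumberTheory.Automorphic.satakePairPolynomial {1} {1} *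
      Literature.NumberTheory.Automorphic.satakePairPolynomial {(c * d * (a * b)⁻¹) ^ 3} {1} =
      Literature.NumberTheory.Automorphic.satakePairPolynomial {a, b, c, d}
      (({a, b, c, d} : Multiset ℂ).map ((a * b)⁻¹ * (c * d * (a * b)⁻¹) * ·)) *
      Literature.NumberTheory.Automorphic.satakePairPolynomial (({a, b, c, d} : Multiset ℂ).map (·⁻¹))
      ((({a, b, c, d} : Multiset ℂ).map (·⁻¹)).map (a * b * (c * d * (a * b)⁻¹) ^ 2 * ·)) *
      Literature.NumberTheory.Automorphic.satakePairPolynomial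
      (Literature.NumberTheory.Automorphic.wedgeTwoParams {a, b, c, d}) {(a * b)⁻¹} *
      Literature.NumberTheory.Automorphic.satakePairPolynomial
      (Literature.NumberTheory.Automorphic.wedgeTwoParams {a, b, c, d})
      {(a * b)⁻¹ * (c * d * (a * b)⁻¹) ^ 2} *
      Literature.NumberTheory.Automorphic.satakePairPolynomial {c * d * (a * b)⁻¹} {1} *
      Literature.NumberTheory.Automorphic.satakePairPolynomial {(c * d * (a * b)⁻¹) ^ 2} {1})
    (hJ2 : JacquetShalika1981_partialPairL_boundary_repData)
    (hJ3 : JacquetShalika1981_partialPairL_pole_repData)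
    {h4 : isCompact_glFiniteIntegralLevel 4 F} {h6 : isCompact_glFiniteIntegralLevel 6 F}
    (P Pd : CuspidalAutomorphicRepData 4 F h4) (Q : CuspidalAutomorphicRepData 6 F h6)
    (β : SatakeFamily F)
    (hP : ∀ᶠ w : HeightOneSpectrum (𝓞 F) in cofinite, P.1.HasSatakeParamAt w (β w))
    (hPd : ∀ᶠ w : HeightOneSpectrum (𝓞 F) in cofinite, Pd.1.HasSatakeParamAt w ((β w).map (·⁻¹)))
    (hQ : ∀ᶠ w : HeightOneSpectrum (𝓞 F) in cofinite,
      Q.1.HasSatakeParamAt w (wedgeTwoParams (β w)))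
    (huβ : ∀ᶠ w : HeightOneSpectrum (𝓞 F) in cofinite, ‖(β w).prod‖ = 1)
    (ω : HeckeCharacter F)
    (hω : ∀ᶠ w : HeightOneSpectrum (𝓞 F) in cofinite, ω.valueAtUniformizer w = (β w).prod)
    (hnesd : ∀ e : HeckeCharacter F, ¬ ∀ᶠ w : HeightOneSpectrum (𝓞 F) in cofinite,
      (β w).map (·⁻¹) = (β w).map (e.valueAtUniformizer w * ·))
    (χ : HeckeCharacter F)
    (hχ : ∀ᶠ w : HeightOneSpectrum (𝓞 F) in cofinite, ∃ S T : Multiset ℂ,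
      S + T = β w ∧ Multiset.card S = 2 ∧ S.prod = χ.valueAtUniformizer w)
    {t : ℝ} (ht : 0 ≤ t)
    (hχt : ∀ x : ideleGroup F, ‖((χ x : ℂˣ) : ℂ)‖ = GaloisRepresentations.ideleNorm x ^ (-t)) :
    False := by
  have h1 : isCompact_glFiniteIntegralLevel 1 F := isCompact_glFiniteIntegralLevel_holds 1 F
  haveI : NeZero (4 : ℕ) := ⟨by norm_num⟩
  haveI : NeZero (6 : ℕ) := ⟨by norm_num⟩
  -- the norm-power character `lam(ϖ_w) = q_w^{t}` and the unitary `u₁ = χ⁻¹ lam`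
  obtain ⟨lam, hlam⟩ := exists_heckeCharacter_ideleNorm_cpow F (((-t : ℝ)) : ℂ)
  have hc : ∀ w : HeightOneSpectrum (𝓞 F),
      lam.valueAtUniformizer w = ((w.residueCard : ℂ) ^ (((-t : ℝ)) : ℂ))⁻¹ :=
    HeckeCharacter.valueAtUniformizer_of_cpow hlam
  have hc0 : ∀ w : HeightOneSpectrum (𝓞 F), (w.residueCard : ℂ) ^ (((-t : ℝ)) : ℂ) ≠ 0 :=
    fun w => qpow_ne_zero_twoTwo w _
  have hnχ : ∀ w : HeightOneSpectrum (𝓞 F), ‖χ.valueAtUniformizer w‖ = (w.residueCard : ℝ) ^ t :=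
    fun w => by rw [norm_valueAtUniformizer_eq_rpow_neg_of_norm_apply hχt, neg_neg]
  set u₁ : HeckeCharacter F := χ⁻¹ * lam with hu₁def
  have hu₁w : ∀ w, u₁.valueAtUniformizer w =
      (χ.valueAtUniformizer w)⁻¹ * ((w.residueCard : ℂ) ^ (((-t : ℝ)) : ℂ))⁻¹ := fun w => by
    rw [hu₁def, HeckeCharacter.valueAtUniformizer_mul, HeckeCharacter.valueAtUniformizer_inv, hc]
  have hχinv : ∀ w, (χ.valueAtUniformizer w)⁻¹ =
      (w.residueCard : ℂ) ^ (((-t : ℝ)) : ℂ) * u₁.valueAtUniformizer w := fun w => by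
    rw [hu₁w, mul_comm ((χ.valueAtUniformizer w)⁻¹), ← mul_assoc, mul_inv_cancel₀ (hc0 w), one_mul]
  have hnu₁ : ∀ w, ‖u₁.valueAtUniformizer w‖ = 1 := fun w => by
    have hq : (0 : ℝ) < w.residueCard := by exact_mod_cast lt_trans zero_lt_one w.one_lt_residueCard
    rw [hu₁w, norm_mul, norm_inv, norm_inv, hnχ, norm_qpow_twoTwo, Complex.ofReal_re,
      Real.rpow_neg hq.le, inv_inv, inv_mul_cancel₀ (Real.rpow_pos_of_pos hq t).ne']
  -- the unitary a.e. characters `ω^i u₁^j` (twisting characters `ω^i χ^{-j}` shifted by `q^{-jt}`)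
  set uA : HeckeCharacter F := ω * u₁ ^ 2 with huAdef
  set uB : HeckeCharacter F := ω ^ 2 * u₁ ^ 4 with huBdef
  set uC : HeckeCharacter F := ω * u₁ ^ 3 with huCdef
  set uD : HeckeCharacter F := ω ^ 3 * u₁ ^ 6 with huDdef
  set uE : HeckeCharacter F := ω ^ 2 * u₁ ^ 3 with huEdef
  set uG : HeckeCharacter F := ω ^ 2 * u₁ ^ 5 with huGdef
  have huAw : ∀ w, uA.valueAtUniformizer w = ω.valueAtUniformizer w * u₁.valueAtUniformizer w ^ 2 :=
    fun w => by rw [huAdef, HeckeCharacter.valueAtUniformizer_mul, HeckeCharacter.valueAtUniformizer_pow]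
  have huBw : ∀ w, uB.valueAtUniformizer w =
      ω.valueAtUniformizer w ^ 2 * u₁.valueAtUniformizer w ^ 4 := fun w => by
    rw [huBdef, HeckeCharacter.valueAtUniformizer_mul, HeckeCharacter.valueAtUniformizer_pow,
      HeckeCharacter.valueAtUniformizer_pow]
  have huCw : ∀ w, uC.valueAtUniformizer w = ω.valueAtUniformizer w * u₁.valueAtUniformizer w ^ 3 :=
    fun w => by rw [huCdef, HeckeCharacter.valueAtUniformizer_mul, HeckeCharacter.valueAtUniformizer_pow]
  have huDw : ∀ w, uD.valueAtUniformizer w =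
      ω.valueAtUniformizer w ^ 3 * u₁.valueAtUniformizer w ^ 6 := fun w => by
    rw [huDdef, HeckeCharacter.valueAtUniformizer_mul, HeckeCharacter.valueAtUniformizer_pow,
      HeckeCharacter.valueAtUniformizer_pow]
  have huEw : ∀ w, uE.valueAtUniformizer w =
      ω.valueAtUniformizer w ^ 2 * u₁.valueAtUniformizer w ^ 3 := fun w => by
    rw [huEdef, HeckeCharacter.valueAtUniformizer_mul, HeckeCharacter.valueAtUniformizer_pow,
      HeckeCharacter.valueAtUniformizer_pow]
  have huGw : ∀ w, uG.valueAtUniformizer w =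
      ω.valueAtUniformizer w ^ 2 * u₁.valueAtUniformizer w ^ 5 := fun w => by
    rw [huGdef, HeckeCharacter.valueAtUniformizer_mul, HeckeCharacter.valueAtUniformizer_pow,
      HeckeCharacter.valueAtUniformizer_pow]
  have hnω : ∀ᶠ w : HeightOneSpectrum (𝓞 F) in cofinite, ‖ω.valueAtUniformizer w‖ = 1 := by
    filter_upwards [hω, huβ] with w h₁ h₂
    rw [h₁, h₂]
  have hnuA : ∀ᶠ w : HeightOneSpectrum (𝓞 F) in cofinite, ‖uA.valueAtUniformizer w‖ = 1 :=
    hnω.mono fun w hw => by rw [huAw, norm_mul, norm_pow, hw, hnu₁, one_pow, one_mul]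
  have hnuB : ∀ᶠ w : HeightOneSpectrum (𝓞 F) in cofinite, ‖uB.valueAtUniformizer w‖ = 1 :=
    hnω.mono fun w hw => by rw [huBw, norm_mul, norm_pow, norm_pow, hw, hnu₁, one_pow, one_pow, one_mul]
  have hnuC : ∀ᶠ w : HeightOneSpectrum (𝓞 F) in cofinite, ‖uC.valueAtUniformizer w‖ = 1 :=
    hnω.mono fun w hw => by rw [huCw, norm_mul, norm_pow, hw, hnu₁, one_pow, one_mul]
  have hnuD : ∀ᶠ w : HeightOneSpectrum (𝓞 F) in cofinite, ‖uD.valueAtUniformizer w‖ = 1 :=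
    hnω.mono fun w hw => by rw [huDw, norm_mul, norm_pow, norm_pow, hw, hnu₁, one_pow, one_pow, one_mul]
  have hnuE : ∀ᶠ w : HeightOneSpectrum (𝓞 F) in cofinite, ‖uE.valueAtUniformizer w‖ = 1 :=
    hnω.mono fun w hw => by rw [huEw, norm_mul, norm_pow, norm_pow, hw, hnu₁, one_pow, one_pow, one_mul]
  have hnuG : ∀ᶠ w : HeightOneSpectrum (𝓞 F) in cofinite, ‖uG.valueAtUniformizer w‖ = 1 :=
    hnω.mono fun w hw => by rw [huGw, norm_mul, norm_pow, norm_pow, hw, hnu₁, one_pow, one_pow, one_mul]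
  -- the families
  set βi : SatakeFamily F := fun w => (β w).map (·⁻¹) with hβidef
  set W : SatakeFamily F := fun w => wedgeTwoParams (β w) with hWdef
  set γA : SatakeFamily F := fun w => (βi w).map (uA.valueAtUniformizer w * ·) with hγAdef
  set γB : SatakeFamily F := fun w => (βi w).map (uB.valueAtUniformizer w * ·) with hγBdef
  set δC : SatakeFamily F := fun w => (β w).map (uC.valueAtUniformizer w * ·) with hδCdef
  set δE : SatakeFamily F := fun w => (βi w).map (uE.valueAtUniformizer w * ·) with hδEdef
  -- the twisted data
  obtain ⟨PdA, hPdA⟩ := CuspidalAutomorphicRepData.exists_twist_hecke_hasSatakeParamAt uA Pd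
  obtain ⟨PdB, hPdB⟩ := CuspidalAutomorphicRepData.exists_twist_hecke_hasSatakeParamAt uB Pd
  obtain ⟨PC, hPC⟩ := CuspidalAutomorphicRepData.exists_twist_hecke_hasSatakeParamAt uC P
  obtain ⟨PdE, hPdE⟩ := CuspidalAutomorphicRepData.exists_twist_hecke_hasSatakeParamAt uE Pd
  have hPdAγ : ∀ᶠ w : HeightOneSpectrum (𝓞 F) in cofinite, PdA.1.HasSatakeParamAt w (γA w) := by
    filter_upwards [hPd, hPdA] with w h h'
    exact h' _ h
  have hPdBγ : ∀ᶠ w : HeightOneSpectrum (𝓞 F) in cofinite, PdB.1.HasSatakeParamAt w (γB w) := by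
    filter_upwards [hPd, hPdB] with w h h'
    exact h' _ h
  have hPCδ : ∀ᶠ w : HeightOneSpectrum (𝓞 F) in cofinite, PC.1.HasSatakeParamAt w (δC w) := by
    filter_upwards [hP, hPC] with w h h'
    exact h' _ h
  have hPdEδ : ∀ᶠ w : HeightOneSpectrum (𝓞 F) in cofinite, PdE.1.HasSatakeParamAt w (δE w) := by
    filter_upwards [hPd, hPdE] with w h h'
    exact h' _ h
  -- unitarity of the families
  have huβi : ∀ᶠ w : HeightOneSpectrum (𝓞 F) in cofinite, ‖(βi w).prod‖ = 1 :=
    huβ.mono fun w hw => by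
      show ‖((β w).map (·⁻¹)).prod‖ = 1
      rw [Multiset.prod_map_inv, Multiset.map_id', norm_inv, hw, inv_one]
  have huW : ∀ᶠ w : HeightOneSpectrum (𝓞 F) in cofinite, ‖(W w).prod‖ = 1 := by
    filter_upwards [hP, huβ] with w h₁ h₂
    show ‖(wedgeTwoParams (β w)).prod‖ = 1
    rw [prod_wedgeTwoParams_of_card_eq_four h₁.card_eq, norm_pow, h₂, one_pow]
  have huγA : ∀ᶠ w : HeightOneSpectrum (𝓞 F) in cofinite, ‖(γA w).prod‖ = 1 := by
    filter_upwards [hP, huβi, hnuA] with w h₀ h₁ h₂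
    show ‖(((β w).map (·⁻¹)).map (uA.valueAtUniformizer w * ·)).prod‖ = 1
    rw [prod_map_const_mul_eq, Multiset.card_map, h₀.card_eq, norm_mul, norm_pow, h₂, one_pow, one_mul]
    exact h₁
  have huγB : ∀ᶠ w : HeightOneSpectrum (𝓞 F) in cofinite, ‖(γB w).prod‖ = 1 := by
    filter_upwards [hP, huβi, hnuB] with w h₀ h₁ h₂
    show ‖(((β w).map (·⁻¹)).map (uB.valueAtUniformizer w * ·)).prod‖ = 1
    rw [prod_map_const_mul_eq, Multiset.card_map, h₀.card_eq, norm_mul, norm_pow, h₂, one_pow, one_mul]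
    exact h₁
  have huδC : ∀ᶠ w : HeightOneSpectrum (𝓞 F) in cofinite, ‖(δC w).prod‖ = 1 := by
    filter_upwards [hP, huβ, hnuC] with w h₀ h₁ h₂
    show ‖((β w).map (uC.valueAtUniformizer w * ·)).prod‖ = 1
    rw [prod_map_const_mul_eq, h₀.card_eq, norm_mul, norm_pow, h₂, one_pow, one_mul]
    exact h₁
  have huδE : ∀ᶠ w : HeightOneSpectrum (𝓞 F) in cofinite, ‖(δE w).prod‖ = 1 := by
    filter_upwards [hP, huβi, hnuE] with w h₀ h₁ h₂
    show ‖(((β w).map (·⁻¹)).map (uE.valueAtUniformizer w * ·)).prod‖ = 1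
    rw [prod_map_const_mul_eq, Multiset.card_map, h₀.card_eq, norm_mul, norm_pow, h₂, one_pow, one_mul]
    exact h₁
  -- the packages of the eleven non-`ζ` slots
  obtain ⟨SA, hSA, pkA⟩ := hPk F 4 h4 hJ2 hJ3 P PdA β γA hP hPdAγ huβ huγA
  obtain ⟨SB, hSB, pkB⟩ := hPk F 4 h4 hJ2 hJ3 P PdB β γB hP hPdBγ huβ huγB
  obtain ⟨SC, hSC, pkC⟩ := analyticPackage_repData hJ2 (n := 6) (by norm_num) Q W hQ huW uC hnuC
  obtain ⟨SD, hSD, pkD⟩ := hGl F uD hnuD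
  obtain ⟨SE, hSE, pkE⟩ := hPk F 4 h4 hJ2 hJ3 P PC β δC hP hPCδ huβ huδC
  obtain ⟨SF, hSF, pkF⟩ := hPk F 4 h4 hJ2 hJ3 Pd PdE βi δE hPd hPdEδ huβi huδE
  obtain ⟨SG, hSG, pkG⟩ := analyticPackage_repData hJ2 (n := 6) (by norm_num) Q W hQ huW u₁
    (Filter.Eventually.of_forall hnu₁)
  obtain ⟨SH, hSH, pkH⟩ := analyticPackage_repData hJ2 (n := 6) (by norm_num) Q W hQ huW uG hnuG
  obtain ⟨SI, hSI, pkI⟩ := hGl F uA hnuA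
  obtain ⟨SJ, hSJ, pkJ⟩ := hGl F uB hnuB
  -- the `ζ` slot: the trivial `GL₁` datum and (2.1)
  obtain ⟨τ₀, hτ₀⟩ := exists_cuspidal_glOne_hasSatakeParamAt_one h1
  obtain ⟨S₃, hS₃, hJ1c⟩ :=
    JacquetShalika1981_multipliable_partialPairL_repData_holds 1 1 F h1 h1 one_pos one_pos τ₀ τ₀
  -- the good places
  have hgood : ∀ᶠ w : HeightOneSpectrum (𝓞 F) in cofinite,
      P.1.HasSatakeParamAt w (β w) ∧ ω.valueAtUniformizer w = (β w).prod ∧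
      (∃ S T : Multiset ℂ, S + T = β w ∧ Multiset.card S = 2 ∧ S.prod = χ.valueAtUniformizer w) ∧
      τ₀.1.HasSatakeParamAt w {1} := by
    filter_upwards [hP, hω, hχ, hτ₀] with w h₁ h₂ h₃ h₄
    exact ⟨h₁, h₂, h₃, h₄⟩
  obtain ⟨T₀, hT₀, hgoodT⟩ : ∃ T₀ : Set (HeightOneSpectrum (𝓞 F)), T₀.Finite ∧ ∀ w ∉ T₀,
      P.1.HasSatakeParamAt w (β w) ∧ ω.valueAtUniformizer w = (β w).prod ∧
      (∃ S T : Multiset ℂ, S + T = β w ∧ Multiset.card S = 2 ∧ S.prod = χ.valueAtUniformizer w) ∧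
      τ₀.1.HasSatakeParamAt w {1} :=
    ⟨_, Filter.eventually_cofinite.1 hgood, fun w hw => not_not.1 hw⟩
  set T : Set (HeightOneSpectrum (𝓞 F)) :=
    T₀ ∪ SA ∪ SB ∪ SC ∪ SD ∪ SE ∪ SF ∪ SG ∪ SH ∪ SI ∪ SJ ∪ S₃ with hT_def
  have hT : T.Finite :=
    ((((((((((hT₀.union hSA).union hSB).union hSC).union hSD).union hSE).union hSF).union hSG).union
      hSH).union hSI).union hSJ).union hS₃
  have hT₀T : ∀ w ∉ T, w ∉ T₀ := fun w hw h => hw (by simp [hT_def, h])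
  have subA : SA ⊆ T := fun x hx => by simp [hT_def, hx]
  have subB : SB ⊆ T := fun x hx => by simp [hT_def, hx]
  have subC : SC ⊆ T := fun x hx => by simp [hT_def, hx]
  have subD : SD ⊆ T := fun x hx => by simp [hT_def, hx]
  have subE : SE ⊆ T := fun x hx => by simp [hT_def, hx]
  have subF : SF ⊆ T := fun x hx => by simp [hT_def, hx]
  have subG : SG ⊆ T := fun x hx => by simp [hT_def, hx]
  have subH : SH ⊆ T := fun x hx => by simp [hT_def, hx]
  have subI : SI ⊆ T := fun x hx => by simp [hT_def, hx]
  have subJ : SJ ⊆ T := fun x hx => by simp [hT_def, hx]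
  have sub₃ : S₃ ⊆ T := fun x hx => by simp [hT_def, hx]
  have hτ₀T : ∀ w ∉ T, τ₀.1.HasSatakeParamAt w ((fun _ => ({1} : Multiset ℂ)) w) :=
    fun w hw => (hgoodT w (hT₀T w hw)).2.2.2
  have huone : ∀ w ∉ T, ‖((fun _ => ({1} : Multiset ℂ)) w).prod‖ = 1 := fun w _ => by simp
  -- powers of the local constant `q_w^{-t}`
  have hck : ∀ (k : ℕ) (w : HeightOneSpectrum (𝓞 F)),
      (w.residueCard : ℂ) ^ (((-(k * t) : ℝ)) : ℂ) = ((w.residueCard : ℂ) ^ (((-t : ℝ)) : ℂ)) ^ k :=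
    fun k w => by
    rw [← Complex.cpow_nat_mul]; congr 1; push_cast; ring
  -- the Euler-factor identity at a good place
  have hId : ∀ w ∉ T,
      satakePairPolynomial (β w) ((γA w).map (((w.residueCard : ℂ) ^ (((-(2 * t) : ℝ)) : ℂ)) * ·)) *
          satakePairPolynomial (β w) ((γB w).map (((w.residueCard : ℂ) ^ (((-(4 * t) : ℝ)) : ℂ)) * ·)) *
          satakePairPolynomial (W w)
            (({uC.valueAtUniformizer w} : Multiset ℂ).map
              (((w.residueCard : ℂ) ^ (((-(3 * t) : ℝ)) : ℂ)) * ·)) *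
          satakePairPolynomial (W w)
            (({uC.valueAtUniformizer w} : Multiset ℂ).map
              (((w.residueCard : ℂ) ^ (((-(3 * t) : ℝ)) : ℂ)) * ·)) *
          satakePairPolynomial
            (({uD.valueAtUniformizer w} : Multiset ℂ).map
              (((w.residueCard : ℂ) ^ (((-(6 * t) : ℝ)) : ℂ)) * ·)) {1} *
          satakePairPolynomial {1} {1} =
        satakePairPolynomial (β w) ((δC w).map (((w.residueCard : ℂ) ^ (((-(3 * t) : ℝ)) : ℂ)) * ·)) *
          satakePairPolynomial (βi w) ((δE w).map (((w.residueCard : ℂ) ^ (((-(3 * t) : ℝ)) : ℂ)) * ·)) *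
          satakePairPolynomial (W w)
            (({u₁.valueAtUniformizer w} : Multiset ℂ).map
              (((w.residueCard : ℂ) ^ (((-(1 * t) : ℝ)) : ℂ)) * ·)) *
          satakePairPolynomial (W w)
            (({uG.valueAtUniformizer w} : Multiset ℂ).map
              (((w.residueCard : ℂ) ^ (((-(5 * t) : ℝ)) : ℂ)) * ·)) *
          satakePairPolynomial
            (({uA.valueAtUniformizer w} : Multiset ℂ).map
              (((w.residueCard : ℂ) ^ (((-(2 * t) : ℝ)) : ℂ)) * ·)) {1} *
          satakePairPolynomial
            (({uB.valueAtUniformizer w} : Multiset ℂ).map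
              (((w.residueCard : ℂ) ^ (((-(4 * t) : ℝ)) : ℂ)) * ·)) {1} := by
    intro w hw
    have hg := hgoodT w (hT₀T w hw)
    obtain ⟨Sm, Tm, hST, hcardS, hSprod⟩ := hg.2.2.1
    obtain ⟨a, b, rfl⟩ := Multiset.card_eq_two.1 hcardS
    have hcardT : Multiset.card Tm = 2 := by
      have h4c := hg.1.card_eq
      rw [← hST, Multiset.card_add, hcardS] at h4c
      omega
    obtain ⟨c, d, rfl⟩ := Multiset.card_eq_two.1 hcardT
    have hβw : β w = {a, b, c, d} := by rw [← hST, pair_add_pair]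
    have h0 : (0 : ℂ) ∉ β w := fun h0 => hasSatakeParamAt_ne_zero_holds hg.1 0 h0 rfl
    have ha : a ≠ 0 := fun h => h0 (by rw [hβw, h]; simp)
    have hb : b ≠ 0 := fun h => h0 (by rw [hβw, h]; simp)
    have hcc : c ≠ 0 := fun h => h0 (by rw [hβw, h]; simp)
    have hd : d ≠ 0 := fun h => h0 (by rw [hβw, h]; simp)
    have hab : a * b ≠ 0 := mul_ne_zero ha hb
    have hx : χ.valueAtUniformizer w = a * b := by
      rw [← hSprod, Multiset.insert_eq_cons, Multiset.prod_cons, Multiset.prod_singleton]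
    have hωw : ω.valueAtUniformizer w = a * b * (c * d) := by
      rw [hg.2.1, hβw]
      simp only [Multiset.insert_eq_cons, Multiset.prod_cons, Multiset.prod_singleton]
      ring
    have hC0 : (w.residueCard : ℂ) ^ (((-t : ℝ)) : ℂ) ≠ 0 := hc0 w
    -- `q^{-t} u₁(ϖ) = χ(ϖ)⁻¹ = (ab)⁻¹`
    have k1 : (w.residueCard : ℂ) ^ (((-t : ℝ)) : ℂ) * u₁.valueAtUniformizer w = (a * b)⁻¹ := by
      rw [← hχinv, hx]
    have k2 : ∀ k : ℕ, ((w.residueCard : ℂ) ^ (((-t : ℝ)) : ℂ)) ^ k * u₁.valueAtUniformizer w ^ k =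
        (a * b)⁻¹ ^ k := fun k => by rw [← mul_pow, k1]
    -- the twelve scalars
    have vA : (w.residueCard : ℂ) ^ (((-(2 * t) : ℝ)) : ℂ) * uA.valueAtUniformizer w =
        c * d * (a * b)⁻¹ := by
      rw [show (2 : ℝ) * t = ((2 : ℕ) : ℝ) * t by push_cast; ring, hck, huAw, hωw,
        show ((w.residueCard : ℂ) ^ (((-t : ℝ)) : ℂ)) ^ 2 * (a * b * (c * d) * u₁.valueAtUniformizer w ^ 2) =
          a * b * (c * d) * (((w.residueCard : ℂ) ^ (((-t : ℝ)) : ℂ)) ^ 2 * u₁.valueAtUniformizer w ^ 2)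
          by ring, k2]
      field_simp
    have vB : (w.residueCard : ℂ) ^ (((-(4 * t) : ℝ)) : ℂ) * uB.valueAtUniformizer w =
        (c * d * (a * b)⁻¹) ^ 2 := by
      rw [show (4 : ℝ) * t = ((4 : ℕ) : ℝ) * t by push_cast; ring, hck, huBw, hωw,
        show ((w.residueCard : ℂ) ^ (((-t : ℝ)) : ℂ)) ^ 4 *
            ((a * b * (c * d)) ^ 2 * u₁.valueAtUniformizer w ^ 4) =
          (a * b * (c * d)) ^ 2 * (((w.residueCard : ℂ) ^ (((-t : ℝ)) : ℂ)) ^ 4 * u₁.valueAtUniformizer w ^ 4)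
          by ring, k2]
      field_simp
    have vC : (w.residueCard : ℂ) ^ (((-(3 * t) : ℝ)) : ℂ) * uC.valueAtUniformizer w =
        (a * b)⁻¹ * (c * d * (a * b)⁻¹) := by
      rw [show (3 : ℝ) * t = ((3 : ℕ) : ℝ) * t by push_cast; ring, hck, huCw, hωw,
        show ((w.residueCard : ℂ) ^ (((-t : ℝ)) : ℂ)) ^ 3 * (a * b * (c * d) * u₁.valueAtUniformizer w ^ 3) =
          a * b * (c * d) * (((w.residueCard : ℂ) ^ (((-t : ℝ)) : ℂ)) ^ 3 * u₁.valueAtUniformizer w ^ 3)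
          by ring, k2]
      field_simp
    have vD : (w.residueCard : ℂ) ^ (((-(6 * t) : ℝ)) : ℂ) * uD.valueAtUniformizer w =
        (c * d * (a * b)⁻¹) ^ 3 := by
      rw [show (6 : ℝ) * t = ((6 : ℕ) : ℝ) * t by push_cast; ring, hck, huDw, hωw,
        show ((w.residueCard : ℂ) ^ (((-t : ℝ)) : ℂ)) ^ 6 *
            ((a * b * (c * d)) ^ 3 * u₁.valueAtUniformizer w ^ 6) =
          (a * b * (c * d)) ^ 3 * (((w.residueCard : ℂ) ^ (((-t : ℝ)) : ℂ)) ^ 6 * u₁.valueAtUniformizer w ^ 6)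
          by ring, k2]
      field_simp
    have vE : (w.residueCard : ℂ) ^ (((-(3 * t) : ℝ)) : ℂ) * uE.valueAtUniformizer w =
        a * b * (c * d * (a * b)⁻¹) ^ 2 := by
      rw [show (3 : ℝ) * t = ((3 : ℕ) : ℝ) * t by push_cast; ring, hck, huEw, hωw,
        show ((w.residueCard : ℂ) ^ (((-t : ℝ)) : ℂ)) ^ 3 *
            ((a * b * (c * d)) ^ 2 * u₁.valueAtUniformizer w ^ 3) =
          (a * b * (c * d)) ^ 2 * (((w.residueCard : ℂ) ^ (((-t : ℝ)) : ℂ)) ^ 3 * u₁.valueAtUniformizer w ^ 3)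
          by ring, k2]
      field_simp
    have vG3 : (w.residueCard : ℂ) ^ (((-(1 * t) : ℝ)) : ℂ) * u₁.valueAtUniformizer w = (a * b)⁻¹ := by
      rw [one_mul, k1]
    have vG : (w.residueCard : ℂ) ^ (((-(5 * t) : ℝ)) : ℂ) * uG.valueAtUniformizer w =
        (a * b)⁻¹ * (c * d * (a * b)⁻¹) ^ 2 := by
      rw [show (5 : ℝ) * t = ((5 : ℕ) : ℝ) * t by push_cast; ring, hck, huGw, hωw,
        show ((w.residueCard : ℂ) ^ (((-t : ℝ)) : ℂ)) ^ 5 *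
            ((a * b * (c * d)) ^ 2 * u₁.valueAtUniformizer w ^ 5) =
          (a * b * (c * d)) ^ 2 * (((w.residueCard : ℂ) ^ (((-t : ℝ)) : ℂ)) ^ 5 * u₁.valueAtUniformizer w ^ 5)
          by ring, k2]
      field_simp
    -- rewrite the twelve families
    have eA : (γA w).map (((w.residueCard : ℂ) ^ (((-(2 * t) : ℝ)) : ℂ)) * ·) =
        (({a, b, c, d} : Multiset ℂ).map (·⁻¹)).map (c * d * (a * b)⁻¹ * ·) := by
      show (((β w).map (·⁻¹)).map (uA.valueAtUniformizer w * ·)).map _ = _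
      rw [map_const_mul_map_const_mul, vA, hβw]
    have eB : (γB w).map (((w.residueCard : ℂ) ^ (((-(4 * t) : ℝ)) : ℂ)) * ·) =
        (({a, b, c, d} : Multiset ℂ).map (·⁻¹)).map ((c * d * (a * b)⁻¹) ^ 2 * ·) := by
      show (((β w).map (·⁻¹)).map (uB.valueAtUniformizer w * ·)).map _ = _
      rw [map_const_mul_map_const_mul, vB, hβw]
    have eC : (({uC.valueAtUniformizer w} : Multiset ℂ).map
        (((w.residueCard : ℂ) ^ (((-(3 * t) : ℝ)) : ℂ)) * ·)) = {(a * b)⁻¹ * (c * d * (a * b)⁻¹)} := by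
      rw [Multiset.map_singleton, vC]
    have eD : (({uD.valueAtUniformizer w} : Multiset ℂ).map
        (((w.residueCard : ℂ) ^ (((-(6 * t) : ℝ)) : ℂ)) * ·)) = {(c * d * (a * b)⁻¹) ^ 3} := by
      rw [Multiset.map_singleton, vD]
    have eE₁ : (δC w).map (((w.residueCard : ℂ) ^ (((-(3 * t) : ℝ)) : ℂ)) * ·) =
        ({a, b, c, d} : Multiset ℂ).map ((a * b)⁻¹ * (c * d * (a * b)⁻¹) * ·) := by
      show ((β w).map (uC.valueAtUniformizer w * ·)).map _ = _
      rw [map_const_mul_map_const_mul, vC, hβw]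
    have eE₂ : (δE w).map (((w.residueCard : ℂ) ^ (((-(3 * t) : ℝ)) : ℂ)) * ·) =
        (({a, b, c, d} : Multiset ℂ).map (·⁻¹)).map (a * b * (c * d * (a * b)⁻¹) ^ 2 * ·) := by
      show (((β w).map (·⁻¹)).map (uE.valueAtUniformizer w * ·)).map _ = _
      rw [map_const_mul_map_const_mul, vE, hβw]
    have eG3 : (({u₁.valueAtUniformizer w} : Multiset ℂ).map
        (((w.residueCard : ℂ) ^ (((-(1 * t) : ℝ)) : ℂ)) * ·)) = {(a * b)⁻¹} := by
      rw [Multiset.map_singleton, vG3]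
    have eG4 : (({uG.valueAtUniformizer w} : Multiset ℂ).map
        (((w.residueCard : ℂ) ^ (((-(5 * t) : ℝ)) : ℂ)) * ·)) = {(a * b)⁻¹ * (c * d * (a * b)⁻¹) ^ 2} := by
      rw [Multiset.map_singleton, vG]
    have eG5 : (({uA.valueAtUniformizer w} : Multiset ℂ).map
        (((w.residueCard : ℂ) ^ (((-(2 * t) : ℝ)) : ℂ)) * ·)) = {c * d * (a * b)⁻¹} := by
      rw [Multiset.map_singleton, vA]
    have eG6 : (({uB.valueAtUniformizer w} : Multiset ℂ).map
        (((w.residueCard : ℂ) ^ (((-(4 * t) : ℝ)) : ℂ)) * ·)) = {(c * d * (a * b)⁻¹) ^ 2} := by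
      rw [Multiset.map_singleton, vB]
    have hWw : W w = wedgeTwoParams {a, b, c, d} := by
      show wedgeTwoParams (β w) = _
      rw [hβw]
    have hβiw : βi w = ({a, b, c, d} : Multiset ℂ).map (·⁻¹) := by
      show (β w).map (·⁻¹) = _
      rw [hβw]
    have h46 := hId46 a b c d ha hb hcc hd
    rw [mul_right_comm _ (satakePairPolynomial {1} {1})] at h46
    rw [eA, eB, eC, eD, eE₁, eE₂, eG3, eG4, eG5, eG6, hWw, hβiw, hβw]
    exact h46
  -- the boundary filter and translates
  have hl : ∀ z : ℂ, Tendsto (fun s : ℂ => s - z) (𝓝[{s : ℂ | 1 < s.re}] 1) (𝓝 (1 - z)) :=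
    fun z => ((continuous_id.sub continuous_const).tendsto 1).mono_left nhdsWithin_le_nhds
  have hone : ∀ w : HeightOneSpectrum (𝓞 F), (fun _ : HeightOneSpectrum (𝓞 F) => ({1} : Multiset ℂ)) w = {1} :=
    fun _ => rfl
  -- the packages off `T`
  have pkAT := pkA T hT subA
  have pkBT := pkB T hT subB
  have pkCT := pkC hT subC
  have pkDT := pkD T hT subD
  have pkET := pkE T hT subE
  have pkFT := pkF T hT subF
  have pkGT := pkG hT subG
  have pkHT := pkH hT subH
  have pkIT := pkI T hT subI
  have pkJT := pkJ T hT subJ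
  -- `ζ`: (2.1) and Hecke's pole
  have mZ : ∀ s : ℂ, 1 < s.re → Multipliable fun v : {v : HeightOneSpectrum (𝓞 F) // v ∉ T} =>
      ((satakePairPolynomial ((fun _ => ({1} : Multiset ℂ)) v.1) ((fun _ => ({1} : Multiset ℂ)) v.1)).eval
        ((v.1.residueCard : ℂ) ^ (-s)))⁻¹ :=
    fun s hs => hJ1c hT sub₃ hτ₀T hτ₀T huone huone hs
  obtain ⟨c₀, hc₀', hZ⟩ := tendsto_sub_one_mul_partialPairL_one_one hT hone
  -- `P` is not essentially self-dual: the two `GL₄ × GL₄` slots of the right side are off `X`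
  have nXE : ¬ ∀ᶠ w : HeightOneSpectrum (𝓞 F) in cofinite, β w = (δC w).map (·⁻¹) := fun hX =>
    hnesd uC (hX.mono fun w hw => by
      have hu0 : uC.valueAtUniformizer w ≠ 0 := heckeCharacter_valueAtUniformizer_ne_zero uC w
      have h1 : (δC w).map (·⁻¹) = ((β w).map (·⁻¹)).map ((uC.valueAtUniformizer w)⁻¹ * ·) := by
        show ((β w).map (uC.valueAtUniformizer w * ·)).map (·⁻¹) = _
        exact map_inv_map_const_mul _ _
      have hw' : β w = ((β w).map (·⁻¹)).map ((uC.valueAtUniformizer w)⁻¹ * ·) := hw.trans h1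
      have h3 : (β w).map (uC.valueAtUniformizer w * ·) = (β w).map (·⁻¹) := by
        conv_lhs => rw [hw']
        rw [map_const_mul_map_const_mul, mul_inv_cancel₀ hu0]
        simp only [one_mul, Multiset.map_id']
      exact h3.symm)
  have nXF : ¬ ∀ᶠ w : HeightOneSpectrum (𝓞 F) in cofinite, βi w = (δE w).map (·⁻¹) := fun hX =>
    hnesd uE⁻¹ (hX.mono fun w hw => by
      have h2 : (δE w).map (·⁻¹) = (β w).map (uE⁻¹.valueAtUniformizer w * ·) := by
        show (((β w).map (·⁻¹)).map (uE.valueAtUniformizer w * ·)).map (·⁻¹) = _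
        rw [map_inv_map_const_mul, satakeParam_inv_inv, HeckeCharacter.valueAtUniformizer_inv]
      rw [← h2, ← hw])
  -- dispatch on the slope
  rcases ht.eq_or_lt with h0t | htpos
  · ----------------------------------------------------------------
    -- `t = 0`: on the unitary axis
    ----------------------------------------------------------------
    subst h0t
    have hId0 : ∀ w ∉ T,
        satakePairPolynomial (β w) (γA w) * satakePairPolynomial (β w) (γB w) *
            satakePairPolynomial (W w) ((fun w => ({uC.valueAtUniformizer w} : Multiset ℂ)) w) *
            satakePairPolynomial (W w) ((fun w => ({uC.valueAtUniformizer w} : Multiset ℂ)) w) *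
            satakePairPolynomial ((fun w => ({uD.valueAtUniformizer w} : Multiset ℂ)) w)
              ((fun _ => ({1} : Multiset ℂ)) w) *
            satakePairPolynomial ((fun _ => ({1} : Multiset ℂ)) w) ((fun _ => ({1} : Multiset ℂ)) w) =
          satakePairPolynomial (β w) (δC w) * satakePairPolynomial (βi w) (δE w) *
            satakePairPolynomial (W w) ((fun w => ({u₁.valueAtUniformizer w} : Multiset ℂ)) w) *
            satakePairPolynomial (W w) ((fun w => ({uG.valueAtUniformizer w} : Multiset ℂ)) w) *
            satakePairPolynomial ((fun w => ({uA.valueAtUniformizer w} : Multiset ℂ)) w)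
              ((fun _ => ({1} : Multiset ℂ)) w) *
            satakePairPolynomial ((fun w => ({uB.valueAtUniformizer w} : Multiset ℂ)) w)
              ((fun _ => ({1} : Multiset ℂ)) w) := by
      intro w hw
      have h := hId w hw
      simpa only [mul_zero, neg_zero, Complex.ofReal_zero, Complex.cpow_zero, one_mul,
        Multiset.map_id'] using h
    -- the identity of partial `L`-functions on `Re s > 1`
    have hEq : ∀ᶠ s in 𝓝[{s : ℂ | 1 < s.re}] 1,
        partialPairL T β γA s * partialPairL T β γB s *
            partialPairL T W (fun w => {uC.valueAtUniformizer w}) s *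
            partialPairL T W (fun w => {uC.valueAtUniformizer w}) s *
            partialPairL T (fun w => {uD.valueAtUniformizer w}) (fun _ => {1}) s *
            partialPairL T (fun _ => {1}) (fun _ => {1}) s =
          partialPairL T β δC s * partialPairL T βi δE s *
            partialPairL T W (fun w => {u₁.valueAtUniformizer w}) s *
            partialPairL T W (fun w => {uG.valueAtUniformizer w}) s *
            partialPairL T (fun w => {uA.valueAtUniformizer w}) (fun _ => {1}) s *
            partialPairL T (fun w => {uB.valueAtUniformizer w}) (fun _ => {1}) s :=
      eventually_nhdsWithin_of_forall fun s hs =>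
        partialPairL_prod_six_eq_of_satakePairPolynomial_eq hId0 (pkAT.1 s hs) (pkBT.1 s hs)
          (pkCT.1 s hs) (pkCT.1 s hs) (pkDT.1 s hs) (mZ s hs) (pkET.1 s hs) (pkFT.1 s hs) (pkGT.1 s hs)
          (pkHT.1 s hs) (pkIT.1 s hs) (pkJT.1 s hs)
    -- slot limits: the pairs (A, G5) and (B, G6) with their exponents
    have hAI : ∃ (e f : ℕ) (ca ci : ℂ), f ≤ e ∧ ca ≠ 0 ∧
        Tendsto (fun s => (s - 1) ^ e * partialPairL T β γA s) (𝓝[{s : ℂ | 1 < s.re}] 1) (𝓝 ca) ∧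
        Tendsto (fun s => (s - 1) ^ f * partialPairL T (fun w => {uA.valueAtUniformizer w}) (fun _ => {1}) s)
          (𝓝[{s : ℂ | 1 < s.re}] 1) (𝓝 ci) := by
      by_cases XI : ∀ᶠ w : HeightOneSpectrum (𝓞 F) in cofinite, uA.valueAtUniformizer w = 1
      · have XA : ∀ᶠ w : HeightOneSpectrum (𝓞 F) in cofinite, β w = (γA w).map (·⁻¹) :=
          XI.mono fun w hw => by
            show β w = (((β w).map (·⁻¹)).map (uA.valueAtUniformizer w * ·)).map (·⁻¹)
            rw [hw]
            simp only [one_mul, Multiset.map_id', satakeParam_inv_inv]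
        obtain ⟨ca, hca, hA⟩ := pkAT.2.2.1 XA
        obtain ⟨ci, -, hI⟩ := pkIT.2.2.1 XI
        exact ⟨1, 1, ca, ci, le_rfl, hca, by simpa only [pow_one] using hA,
          by simpa only [pow_one] using hI⟩
      · obtain ⟨ci, -, hI⟩ := pkIT.2.2.2 XI
        by_cases XA : ∀ᶠ w : HeightOneSpectrum (𝓞 F) in cofinite, β w = (γA w).map (·⁻¹)
        · obtain ⟨ca, hca, hA⟩ := pkAT.2.2.1 XA
          exact ⟨1, 0, ca, ci, Nat.zero_le _, hca, by simpa only [pow_one] using hA,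
            by simpa only [pow_zero, one_mul] using hI⟩
        · obtain ⟨ca, hca, hA⟩ := pkAT.2.2.2 XA
          exact ⟨0, 0, ca, ci, le_rfl, hca, by simpa only [pow_zero, one_mul] using hA,
            by simpa only [pow_zero, one_mul] using hI⟩
    have hBJ : ∃ (e f : ℕ) (cb cj : ℂ), f ≤ e ∧ cb ≠ 0 ∧
        Tendsto (fun s => (s - 1) ^ e * partialPairL T β γB s) (𝓝[{s : ℂ | 1 < s.re}] 1) (𝓝 cb) ∧
        Tendsto (fun s => (s - 1) ^ f * partialPairL T (fun w => {uB.valueAtUniformizer w}) (fun _ => {1}) s)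
          (𝓝[{s : ℂ | 1 < s.re}] 1) (𝓝 cj) := by
      by_cases XJ : ∀ᶠ w : HeightOneSpectrum (𝓞 F) in cofinite, uB.valueAtUniformizer w = 1
      · have XB : ∀ᶠ w : HeightOneSpectrum (𝓞 F) in cofinite, β w = (γB w).map (·⁻¹) :=
          XJ.mono fun w hw => by
            show β w = (((β w).map (·⁻¹)).map (uB.valueAtUniformizer w * ·)).map (·⁻¹)
            rw [hw]
            simp only [one_mul, Multiset.map_id', satakeParam_inv_inv]
        obtain ⟨cb, hcb, hB⟩ := pkBT.2.2.1 XB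
        obtain ⟨cj, -, hJ⟩ := pkJT.2.2.1 XJ
        exact ⟨1, 1, cb, cj, le_rfl, hcb, by simpa only [pow_one] using hB,
          by simpa only [pow_one] using hJ⟩
      · obtain ⟨cj, -, hJ⟩ := pkJT.2.2.2 XJ
        by_cases XB : ∀ᶠ w : HeightOneSpectrum (𝓞 F) in cofinite, β w = (γB w).map (·⁻¹)
        · obtain ⟨cb, hcb, hB⟩ := pkBT.2.2.1 XB
          exact ⟨1, 0, cb, cj, Nat.zero_le _, hcb, by simpa only [pow_one] using hB,
            by simpa only [pow_zero, one_mul] using hJ⟩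
        · obtain ⟨cb, hcb, hB⟩ := pkBT.2.2.2 XB
          exact ⟨0, 0, cb, cj, le_rfl, hcb, by simpa only [pow_zero, one_mul] using hB,
            by simpa only [pow_zero, one_mul] using hJ⟩
    -- the `GL₁` slot `D` (`λ³`): a pole of order `≤ 1`
    have hD : ∃ (e : ℕ) (cd' : ℂ), cd' ≠ 0 ∧
        Tendsto (fun s => (s - 1) ^ e * partialPairL T (fun w => {uD.valueAtUniformizer w}) (fun _ => {1}) s)
          (𝓝[{s : ℂ | 1 < s.re}] 1) (𝓝 cd') := by
      by_cases XD : ∀ᶠ w : HeightOneSpectrum (𝓞 F) in cofinite, uD.valueAtUniformizer w = 1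
      · obtain ⟨c, hc', h⟩ := pkDT.2.2.1 XD
        exact ⟨1, c, hc', by simpa only [pow_one] using h⟩
      · obtain ⟨c, hc', h⟩ := pkDT.2.2.2 XD
        exact ⟨0, c, hc', by simpa only [pow_zero, one_mul] using h⟩
    -- the remaining slots (exponent `0`)
    obtain ⟨cc, hcc0, hC⟩ := pkCT.2.2
    obtain ⟨ce, -, hE⟩ := pkET.2.2.2 nXE
    obtain ⟨cf, -, hF⟩ := pkFT.2.2.2 nXF
    obtain ⟨cg, -, hG⟩ := pkGT.2.2
    obtain ⟨ch, -, hH⟩ := pkHT.2.2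
    obtain ⟨eA', fI, ca, ci, hfe₁, hca, hA, hI⟩ := hAI
    obtain ⟨eB', fJ, cb, cj, hfe₂, hcb, hB, hJ⟩ := hBJ
    obtain ⟨eD, cd', hcd, hDl⟩ := hD
    exact false_of_limits_six_six (l := 𝓝[{s : ℂ | 1 < s.re}] 1)
      (e₁ := eA') (e₂ := eB') (e₃ := 0) (e₄ := 0) (e₅ := eD) (f₁ := 0) (f₂ := 0) (f₃ := 0) (f₄ := 0)
      (f₅ := fI) (f₆ := fJ) (d := (eA' - fI) + (eB' - fJ) + eD) (by omega)
      tendsto_sub_one_nhdsWithin_one_lt_re hEq hA hca hB hcb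
      (by simpa only [pow_zero, one_mul] using hC) hcc0 (by simpa only [pow_zero, one_mul] using hC) hcc0
      hDl hcd hZ hc₀'
      (by simpa only [pow_zero, one_mul] using hE) (by simpa only [pow_zero, one_mul] using hF)
      (by simpa only [pow_zero, one_mul] using hG) (by simpa only [pow_zero, one_mul] using hH) hI hJ
  · ----------------------------------------------------------------
    -- `t > 0`: every twisted factor is shifted into `Re s > 1`
    ----------------------------------------------------------------
    -- the shifted families
    set sγA : SatakeFamily F := fun w => (γA w).map (((w.residueCard : ℂ) ^ (((-(2 * t) : ℝ)) : ℂ)) * ·)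
      with hsγA_def
    set sγB : SatakeFamily F := fun w => (γB w).map (((w.residueCard : ℂ) ^ (((-(4 * t) : ℝ)) : ℂ)) * ·)
      with hsγB_def
    set sC : SatakeFamily F := fun w => ({uC.valueAtUniformizer w} : Multiset ℂ).map
      (((w.residueCard : ℂ) ^ (((-(3 * t) : ℝ)) : ℂ)) * ·) with hsC_def
    set sD : SatakeFamily F := fun w => ({uD.valueAtUniformizer w} : Multiset ℂ).map
      (((w.residueCard : ℂ) ^ (((-(6 * t) : ℝ)) : ℂ)) * ·) with hsD_def
    set sδC : SatakeFamily F := fun w => (δC w).map (((w.residueCard : ℂ) ^ (((-(3 * t) : ℝ)) : ℂ)) * ·)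
      with hsδC_def
    set sδE : SatakeFamily F := fun w => (δE w).map (((w.residueCard : ℂ) ^ (((-(3 * t) : ℝ)) : ℂ)) * ·)
      with hsδE_def
    set sG3 : SatakeFamily F := fun w => ({u₁.valueAtUniformizer w} : Multiset ℂ).map
      (((w.residueCard : ℂ) ^ (((-(1 * t) : ℝ)) : ℂ)) * ·) with hsG3_def
    set sG4 : SatakeFamily F := fun w => ({uG.valueAtUniformizer w} : Multiset ℂ).map
      (((w.residueCard : ℂ) ^ (((-(5 * t) : ℝ)) : ℂ)) * ·) with hsG4_def
    set sG5 : SatakeFamily F := fun w => ({uA.valueAtUniformizer w} : Multiset ℂ).map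
      (((w.residueCard : ℂ) ^ (((-(2 * t) : ℝ)) : ℂ)) * ·) with hsG5_def
    set sG6 : SatakeFamily F := fun w => ({uB.valueAtUniformizer w} : Multiset ℂ).map
      (((w.residueCard : ℂ) ^ (((-(4 * t) : ℝ)) : ℂ)) * ·) with hsG6_def
    -- unshifted `GL₁` families
    set fC : SatakeFamily F := fun w => ({uC.valueAtUniformizer w} : Multiset ℂ) with hfC_def
    set fD : SatakeFamily F := fun w => ({uD.valueAtUniformizer w} : Multiset ℂ) with hfD_def
    set fG3 : SatakeFamily F := fun w => ({u₁.valueAtUniformizer w} : Multiset ℂ) with hfG3_def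
    set fG4 : SatakeFamily F := fun w => ({uG.valueAtUniformizer w} : Multiset ℂ) with hfG4_def
    set fG5 : SatakeFamily F := fun w => ({uA.valueAtUniformizer w} : Multiset ℂ) with hfG5_def
    set fG6 : SatakeFamily F := fun w => ({uB.valueAtUniformizer w} : Multiset ℂ) with hfG6_def
    set one : SatakeFamily F := fun _ => ({1} : Multiset ℂ) with hone_def
    have hsγA : ∀ w ∉ T, sγA w = (γA w).map (((w.residueCard : ℂ) ^ (((-(2 * t) : ℝ)) : ℂ)) * ·) :=
      fun w _ => rfl
    have hsγB : ∀ w ∉ T, sγB w = (γB w).map (((w.residueCard : ℂ) ^ (((-(4 * t) : ℝ)) : ℂ)) * ·) :=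
      fun w _ => rfl
    have hsC : ∀ w ∉ T, sC w = (fC w).map (((w.residueCard : ℂ) ^ (((-(3 * t) : ℝ)) : ℂ)) * ·) :=
      fun w _ => rfl
    have hsD : ∀ w ∉ T, sD w = (fD w).map (((w.residueCard : ℂ) ^ (((-(6 * t) : ℝ)) : ℂ)) * ·) :=
      fun w _ => rfl
    have hsδC : ∀ w ∉ T, sδC w = (δC w).map (((w.residueCard : ℂ) ^ (((-(3 * t) : ℝ)) : ℂ)) * ·) :=
      fun w _ => rfl
    have hsδE : ∀ w ∉ T, sδE w = (δE w).map (((w.residueCard : ℂ) ^ (((-(3 * t) : ℝ)) : ℂ)) * ·) :=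
      fun w _ => rfl
    have hsG3 : ∀ w ∉ T, sG3 w = (fG3 w).map (((w.residueCard : ℂ) ^ (((-(1 * t) : ℝ)) : ℂ)) * ·) :=
      fun w _ => rfl
    have hsG4 : ∀ w ∉ T, sG4 w = (fG4 w).map (((w.residueCard : ℂ) ^ (((-(5 * t) : ℝ)) : ℂ)) * ·) :=
      fun w _ => rfl
    have hsG5 : ∀ w ∉ T, sG5 w = (fG5 w).map (((w.residueCard : ℂ) ^ (((-(2 * t) : ℝ)) : ℂ)) * ·) :=
      fun w _ => rfl
    have hsG6 : ∀ w ∉ T, sG6 w = (fG6 w).map (((w.residueCard : ℂ) ^ (((-(4 * t) : ℝ)) : ℂ)) * ·) :=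
      fun w _ => rfl
    -- Euler factors and partial `L`-functions of the shifted pairs
    have eA' := pairEulerFactor_eq_of_shift (shift_zero_twoTwo (S := T) β) hsγA
    have eB' := pairEulerFactor_eq_of_shift (shift_zero_twoTwo (S := T) β) hsγB
    have eC' := pairEulerFactor_eq_of_shift (shift_zero_twoTwo (S := T) W) hsC
    have eD' := pairEulerFactor_eq_of_shift hsD (shift_zero_twoTwo (S := T) one)
    have eE' := pairEulerFactor_eq_of_shift (shift_zero_twoTwo (S := T) β) hsδC
    have eF' := pairEulerFactor_eq_of_shift (shift_zero_twoTwo (S := T) βi) hsδE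
    have eG' := pairEulerFactor_eq_of_shift (shift_zero_twoTwo (S := T) W) hsG3
    have eH' := pairEulerFactor_eq_of_shift (shift_zero_twoTwo (S := T) W) hsG4
    have eI' := pairEulerFactor_eq_of_shift hsG5 (shift_zero_twoTwo (S := T) one)
    have eJ' := pairEulerFactor_eq_of_shift hsG6 (shift_zero_twoTwo (S := T) one)
    have pA := partialPairL_eq_of_shift (shift_zero_twoTwo (S := T) β) hsγA
    have pB := partialPairL_eq_of_shift (shift_zero_twoTwo (S := T) β) hsγB
    have pC := partialPairL_eq_of_shift (shift_zero_twoTwo (S := T) W) hsC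
    have pD := partialPairL_eq_of_shift hsD (shift_zero_twoTwo (S := T) one)
    have pE := partialPairL_eq_of_shift (shift_zero_twoTwo (S := T) β) hsδC
    have pF := partialPairL_eq_of_shift (shift_zero_twoTwo (S := T) βi) hsδE
    have pG := partialPairL_eq_of_shift (shift_zero_twoTwo (S := T) W) hsG3
    have pH := partialPairL_eq_of_shift (shift_zero_twoTwo (S := T) W) hsG4
    have pI := partialPairL_eq_of_shift hsG5 (shift_zero_twoTwo (S := T) one)
    have pJ := partialPairL_eq_of_shift hsG6 (shift_zero_twoTwo (S := T) one)
    -- real parts of the translates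
    have reR : ∀ (k : ℝ) (s : ℂ), (s - (0 + (((-(k * t) : ℝ)) : ℂ))).re = s.re + k * t := fun k s => by
      simp only [Complex.sub_re, Complex.add_re, Complex.zero_re, Complex.ofReal_re]; ring
    have reL : ∀ (k : ℝ) (s : ℂ), (s - ((((-(k * t) : ℝ)) : ℂ) + 0)).re = s.re + k * t := fun k s => by
      simp only [Complex.sub_re, Complex.add_re, Complex.zero_re, Complex.ofReal_re]; ring
    have hpos : ∀ {k : ℝ}, 0 < k → ∀ {x : ℝ}, 1 ≤ x → 1 < x + k * t := fun hk x hx => by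
      have := mul_pos hk htpos; linarith
    -- multipliability of the twelve shifted Euler products on `Re s > 1`
    have mA : ∀ s : ℂ, 1 < s.re → Multipliable fun v : {v : HeightOneSpectrum (𝓞 F) // v ∉ T} =>
        ((satakePairPolynomial (β v.1) (sγA v.1)).eval ((v.1.residueCard : ℂ) ^ (-s)))⁻¹ := by
      intro s hs; rw [eA' s]
      exact pkAT.1 _ (by rw [reR]; exact hpos (k := 2) (by norm_num) hs.le)
    have mB : ∀ s : ℂ, 1 < s.re → Multipliable fun v : {v : HeightOneSpectrum (𝓞 F) // v ∉ T} =>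
        ((satakePairPolynomial (β v.1) (sγB v.1)).eval ((v.1.residueCard : ℂ) ^ (-s)))⁻¹ := by
      intro s hs; rw [eB' s]
      exact pkBT.1 _ (by rw [reR]; exact hpos (k := 4) (by norm_num) hs.le)
    have mC : ∀ s : ℂ, 1 < s.re → Multipliable fun v : {v : HeightOneSpectrum (𝓞 F) // v ∉ T} =>
        ((satakePairPolynomial (W v.1) (sC v.1)).eval ((v.1.residueCard : ℂ) ^ (-s)))⁻¹ := by
      intro s hs; rw [eC' s]
      exact pkCT.1 _ (by rw [reR]; exact hpos (k := 3) (by norm_num) hs.le)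
    have mD : ∀ s : ℂ, 1 < s.re → Multipliable fun v : {v : HeightOneSpectrum (𝓞 F) // v ∉ T} =>
        ((satakePairPolynomial (sD v.1) (one v.1)).eval ((v.1.residueCard : ℂ) ^ (-s)))⁻¹ := by
      intro s hs; rw [eD' s]
      exact pkDT.1 _ (by rw [reL]; exact hpos (k := 6) (by norm_num) hs.le)
    have mE : ∀ s : ℂ, 1 < s.re → Multipliable fun v : {v : HeightOneSpectrum (𝓞 F) // v ∉ T} =>
        ((satakePairPolynomial (β v.1) (sδC v.1)).eval ((v.1.residueCard : ℂ) ^ (-s)))⁻¹ := by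
      intro s hs; rw [eE' s]
      exact pkET.1 _ (by rw [reR]; exact hpos (k := 3) (by norm_num) hs.le)
    have mF : ∀ s : ℂ, 1 < s.re → Multipliable fun v : {v : HeightOneSpectrum (𝓞 F) // v ∉ T} =>
        ((satakePairPolynomial (βi v.1) (sδE v.1)).eval ((v.1.residueCard : ℂ) ^ (-s)))⁻¹ := by
      intro s hs; rw [eF' s]
      exact pkFT.1 _ (by rw [reR]; exact hpos (k := 3) (by norm_num) hs.le)
    have mG : ∀ s : ℂ, 1 < s.re → Multipliable fun v : {v : HeightOneSpectrum (𝓞 F) // v ∉ T} =>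
        ((satakePairPolynomial (W v.1) (sG3 v.1)).eval ((v.1.residueCard : ℂ) ^ (-s)))⁻¹ := by
      intro s hs; rw [eG' s]
      exact pkGT.1 _ (by rw [reR]; exact hpos (k := 1) (by norm_num) hs.le)
    have mH : ∀ s : ℂ, 1 < s.re → Multipliable fun v : {v : HeightOneSpectrum (𝓞 F) // v ∉ T} =>
        ((satakePairPolynomial (W v.1) (sG4 v.1)).eval ((v.1.residueCard : ℂ) ^ (-s)))⁻¹ := by
      intro s hs; rw [eH' s]
      exact pkHT.1 _ (by rw [reR]; exact hpos (k := 5) (by norm_num) hs.le)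
    have mI : ∀ s : ℂ, 1 < s.re → Multipliable fun v : {v : HeightOneSpectrum (𝓞 F) // v ∉ T} =>
        ((satakePairPolynomial (sG5 v.1) (one v.1)).eval ((v.1.residueCard : ℂ) ^ (-s)))⁻¹ := by
      intro s hs; rw [eI' s]
      exact pkIT.1 _ (by rw [reL]; exact hpos (k := 2) (by norm_num) hs.le)
    have mJ : ∀ s : ℂ, 1 < s.re → Multipliable fun v : {v : HeightOneSpectrum (𝓞 F) // v ∉ T} =>
        ((satakePairPolynomial (sG6 v.1) (one v.1)).eval ((v.1.residueCard : ℂ) ^ (-s)))⁻¹ := by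
      intro s hs; rw [eJ' s]
      exact pkJT.1 _ (by rw [reL]; exact hpos (k := 4) (by norm_num) hs.le)
    -- the identity of partial `L`-functions on `Re s > 1`
    have hEq : ∀ᶠ s in 𝓝[{s : ℂ | 1 < s.re}] 1,
        partialPairL T β sγA s * partialPairL T β sγB s * partialPairL T W sC s * partialPairL T W sC s *
            partialPairL T sD one s * partialPairL T one one s =
          partialPairL T β sδC s * partialPairL T βi sδE s * partialPairL T W sG3 s *
            partialPairL T W sG4 s * partialPairL T sG5 one s * partialPairL T sG6 one s :=
      eventually_nhdsWithin_of_forall fun s hs =>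
        partialPairL_prod_six_eq_of_satakePairPolynomial_eq hId (mA s hs) (mB s hs) (mC s hs) (mC s hs)
          (mD s hs) (mZ s hs) (mE s hs) (mF s hs) (mG s hs) (mH s hs) (mI s hs) (mJ s hs)
    -- the limits of the eleven shifted factors (continuity inside `Re s > 1`)
    obtain ⟨hcA', hA0⟩ := pkAT.2.1 (1 - (0 + (((-(2 * t) : ℝ)) : ℂ)))
      (by rw [reR, Complex.one_re]; exact hpos (k := 2) (by norm_num) le_rfl)
    have hA : Tendsto (partialPairL T β sγA) (𝓝[{s : ℂ | 1 < s.re}] 1)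
        (𝓝 (partialPairL T β γA (1 - (0 + (((-(2 * t) : ℝ)) : ℂ))))) := by
      rw [pA]; exact hcA'.tendsto.comp (hl _)
    obtain ⟨hcB', hB0⟩ := pkBT.2.1 (1 - (0 + (((-(4 * t) : ℝ)) : ℂ)))
      (by rw [reR, Complex.one_re]; exact hpos (k := 4) (by norm_num) le_rfl)
    have hB : Tendsto (partialPairL T β sγB) (𝓝[{s : ℂ | 1 < s.re}] 1)
        (𝓝 (partialPairL T β γB (1 - (0 + (((-(4 * t) : ℝ)) : ℂ))))) := by
      rw [pB]; exact hcB'.tendsto.comp (hl _)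
    obtain ⟨hcC', hC0⟩ := pkCT.2.1 (1 - (0 + (((-(3 * t) : ℝ)) : ℂ)))
      (by rw [reR, Complex.one_re]; exact hpos (k := 3) (by norm_num) le_rfl)
    have hC : Tendsto (partialPairL T W sC) (𝓝[{s : ℂ | 1 < s.re}] 1)
        (𝓝 (partialPairL T W fC (1 - (0 + (((-(3 * t) : ℝ)) : ℂ))))) := by
      rw [pC]; exact hcC'.tendsto.comp (hl _)
    obtain ⟨hcD', hD0⟩ := pkDT.2.1 (1 - ((((-(6 * t) : ℝ)) : ℂ) + 0))
      (by rw [reL, Complex.one_re]; exact hpos (k := 6) (by norm_num) le_rfl)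
    have hD : Tendsto (partialPairL T sD one) (𝓝[{s : ℂ | 1 < s.re}] 1)
        (𝓝 (partialPairL T fD one (1 - ((((-(6 * t) : ℝ)) : ℂ) + 0)))) := by
      rw [pD]; exact hcD'.tendsto.comp (hl _)
    obtain ⟨hcE', -⟩ := pkET.2.1 (1 - (0 + (((-(3 * t) : ℝ)) : ℂ)))
      (by rw [reR, Complex.one_re]; exact hpos (k := 3) (by norm_num) le_rfl)
    have hE : Tendsto (partialPairL T β sδC) (𝓝[{s : ℂ | 1 < s.re}] 1)
        (𝓝 (partialPairL T β δC (1 - (0 + (((-(3 * t) : ℝ)) : ℂ))))) := by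
      rw [pE]; exact hcE'.tendsto.comp (hl _)
    obtain ⟨hcF', -⟩ := pkFT.2.1 (1 - (0 + (((-(3 * t) : ℝ)) : ℂ)))
      (by rw [reR, Complex.one_re]; exact hpos (k := 3) (by norm_num) le_rfl)
    have hF : Tendsto (partialPairL T βi sδE) (𝓝[{s : ℂ | 1 < s.re}] 1)
        (𝓝 (partialPairL T βi δE (1 - (0 + (((-(3 * t) : ℝ)) : ℂ))))) := by
      rw [pF]; exact hcF'.tendsto.comp (hl _)
    obtain ⟨hcG', -⟩ := pkGT.2.1 (1 - (0 + (((-(1 * t) : ℝ)) : ℂ)))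
      (by rw [reR, Complex.one_re]; exact hpos (k := 1) (by norm_num) le_rfl)
    have hG : Tendsto (partialPairL T W sG3) (𝓝[{s : ℂ | 1 < s.re}] 1)
        (𝓝 (partialPairL T W fG3 (1 - (0 + (((-(1 * t) : ℝ)) : ℂ))))) := by
      rw [pG]; exact hcG'.tendsto.comp (hl _)
    obtain ⟨hcH', -⟩ := pkHT.2.1 (1 - (0 + (((-(5 * t) : ℝ)) : ℂ)))
      (by rw [reR, Complex.one_re]; exact hpos (k := 5) (by norm_num) le_rfl)
    have hH : Tendsto (partialPairL T W sG4) (𝓝[{s : ℂ | 1 < s.re}] 1)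
        (𝓝 (partialPairL T W fG4 (1 - (0 + (((-(5 * t) : ℝ)) : ℂ))))) := by
      rw [pH]; exact hcH'.tendsto.comp (hl _)
    obtain ⟨hcI', -⟩ := pkIT.2.1 (1 - ((((-(2 * t) : ℝ)) : ℂ) + 0))
      (by rw [reL, Complex.one_re]; exact hpos (k := 2) (by norm_num) le_rfl)
    have hI : Tendsto (partialPairL T sG5 one) (𝓝[{s : ℂ | 1 < s.re}] 1)
        (𝓝 (partialPairL T fG5 one (1 - ((((-(2 * t) : ℝ)) : ℂ) + 0)))) := by
      rw [pI]; exact hcI'.tendsto.comp (hl _)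
    obtain ⟨hcJ', -⟩ := pkJT.2.1 (1 - ((((-(4 * t) : ℝ)) : ℂ) + 0))
      (by rw [reL, Complex.one_re]; exact hpos (k := 4) (by norm_num) le_rfl)
    have hJ : Tendsto (partialPairL T sG6 one) (𝓝[{s : ℂ | 1 < s.re}] 1)
        (𝓝 (partialPairL T fG6 one (1 - ((((-(4 * t) : ℝ)) : ℂ) + 0)))) := by
      rw [pJ]; exact hcJ'.tendsto.comp (hl _)
    exact false_of_limits_six_six (l := 𝓝[{s : ℂ | 1 < s.re}] 1)
      (e₁ := 0) (e₂ := 0) (e₃ := 0) (e₄ := 0) (e₅ := 0) (f₁ := 0) (f₂ := 0) (f₃ := 0) (f₄ := 0)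
      (f₅ := 0) (f₆ := 0) (d := 0) rfl tendsto_sub_one_nhdsWithin_one_lt_re hEq
      (by simpa only [pow_zero, one_mul] using hA) hA0 (by simpa only [pow_zero, one_mul] using hB) hB0
      (by simpa only [pow_zero, one_mul] using hC) hC0 (by simpa only [pow_zero, one_mul] using hC) hC0
      (by simpa only [pow_zero, one_mul] using hD) hD0 hZ hc₀'
      (by simpa only [pow_zero, one_mul] using hE) (by simpa only [pow_zero, one_mul] using hF)
      (by simpa only [pow_zero, one_mul] using hG) (by simpa only [pow_zero, one_mul] using hH)
      (by simpa only [pow_zero, one_mul] using hI) (by simpa only [pow_zero, one_mul] using hJ)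

end Construction

end Literature.NumberTheory.Automorphic

end
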